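import Mathlib
import Literature.Analysis.FluidPDE.HardSphereCollisionRecordMeasurable
import Summits.AtomisticToContinuum.HydrodynamicLimit.Theorems.OneFlightGossipEngineOneFlightLayeredChaosCollisionTime
import HarnessLib

/-!
# `OneFlightGossipEngine.OneFlightLayeredChaos` — the partner, the record and the kick event of the `n`-th
collision are measurable on the good set (crux stmt-AtomisticToContinuum-14535, helper for every line)

`Φ.nthPartnerOf i n z = partner G ε (Φ_{t_n(z)} z) i` and `Φ.nthRecordOf i n z = ofConfig G ε (Φ_{t_n(z)} z) (t_n z) i
(partner)`. The configuration-level `partner · i` is measurable (it depends on the configuration only through the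
finitely many events `Collide · i j'`, each a contact set), the configuration at the `n`-th collision time is
measurable on `Φ.good` (file `…CollisionTime`), and `ofConfig` is jointly measurable in (time, configuration)
(`HardSphereCollisionRecord.measurable_ofConfig₂_torus`); hence the crux's kick event
`A = {z | (Φ.nthRecordOf i n z).outDir ∈ B}` is measurable on the good set for every measurable `B`. No new
definitions.
-/

open MeasureTheory Set Filter Topology
open Literature.Analysis.FluidPDE

namespace Summit.AtomisticToContinuum.HydrodynamicLimit.Theorems

variable {d : Type*} [Fintype d] {N : ℕ} {ε : ℝ}

/-- The event "`i` and `j` collide" is measurable in the configuration (torus geometry). [folklore] -/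
theorem measurableSet_collide (i j : Fin N) :
    MeasurableSet {w : Config N d (UnitAddTorus d) | Collide (Torus.geometry d) ε w i j} := by
  have hc : ∀ a b : Fin N, MeasurableSet {w : Config N d (UnitAddTorus d) |
      (a, b) ∈ contactPairs (Torus.geometry d) ε w} := by
    intro a b
    by_cases hab : a ≠ b
    · have : {w : Config N d (UnitAddTorus d) | (a, b) ∈ contactPairs (Torus.geometry d) ε w} =
          contactSet (Torus.geometry d) N ε a b := by
        ext w; simp [mem_contactPairs, hab]
      rw [this]
      exact measurableSet_contactSet _ Torus.measurable_geometry_sepVec N ε a b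
    · have : {w : Config N d (UnitAddTorus d) | (a, b) ∈ contactPairs (Torus.geometry d) ε w} = ∅ := by
        ext w; simp [mem_contactPairs, not_not.1 hab]
      rw [this]; exact MeasurableSet.empty
  exact (hc i j).union (hc j i)

/-- `partner G ε w i` depends on `w` only through the events `Collide G ε w i ·`. [folklore] -/
theorem partner_congr {w w' : Config N d (UnitAddTorus d)} {i : Fin N}
    (h : ∀ j, Collide (Torus.geometry d) ε w i j ↔ Collide (Torus.geometry d) ε w' i j) :
    partner (Torus.geometry d) ε w i = partner (Torus.geometry d) ε w' i := by
  classical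
  have hF : (Finset.univ.filter fun j => Collide (Torus.geometry d) ε w i j) =
      (Finset.univ.filter fun j => Collide (Torus.geometry d) ε w' i j) :=
    Finset.filter_congr fun j _ => h j
  unfold partner
  rw [hF]

/-- **The configuration-level partner map is measurable** (values in the finite type `Fin N`). [folklore] -/
theorem measurable_partner (i : Fin N) :
    Measurable fun w : Config N d (UnitAddTorus d) => partner (Torus.geometry d) ε w i := by
  classical
  -- the cells on which the collide-vector is constant
  let E : Finset (Fin N) → Set (Config N d (UnitAddTorus d)) := fun T =>
    ⋂ j : Fin N, {w | Collide (Torus.geometry d) ε w i j ↔ j ∈ T}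
  have hE : ∀ T, MeasurableSet (E T) := by
    intro T
    refine MeasurableSet.iInter fun j => ?_
    by_cases hj : j ∈ T
    · have : {w : Config N d (UnitAddTorus d) | Collide (Torus.geometry d) ε w i j ↔ j ∈ T} =
          {w | Collide (Torus.geometry d) ε w i j} := by ext w; simp [hj]
      rw [this]; exact measurableSet_collide i j
    · have : {w : Config N d (UnitAddTorus d) | Collide (Torus.geometry d) ε w i j ↔ j ∈ T} =
          {w | Collide (Torus.geometry d) ε w i j}ᶜ := by ext w; simp [hj]
      rw [this]; exact (measurableSet_collide i j).compl
  have hcover : ∀ w : Config N d (UnitAddTorus d), w ∈ E (Finset.univ.filter fun j =>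
      Collide (Torus.geometry d) ε w i j) := fun w => mem_iInter.2 fun j => by simp
  refine measurable_to_countable' fun j₀ => ?_
  have hrepr : (fun w : Config N d (UnitAddTorus d) => partner (Torus.geometry d) ε w i) ⁻¹' {j₀} =
    ⋃ T : Finset (Fin N), if (∃ w ∈ E T, partner (Torus.geometry d) ε w i = j₀) then E T else ∅ := by
    ext w
    simp only [mem_preimage, mem_singleton_iff, mem_iUnion]
    constructor
    · intro hw
      refine ⟨Finset.univ.filter fun j => Collide (Torus.geometry d) ε w i j, ?_⟩
      rw [if_pos ⟨w, hcover w, hw⟩]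
      exact hcover w
    · rintro ⟨T, hT⟩
      by_cases hex : ∃ w' ∈ E T, partner (Torus.geometry d) ε w' i = j₀
      · rw [if_pos hex] at hT
        obtain ⟨w', hw', hpw'⟩ := hex
        rw [← hpw']
        refine partner_congr fun j => ?_
        have h1 := (mem_iInter.1 hT) j
        have h2 := (mem_iInter.1 hw') j
        simp only [mem_setOf_eq] at h1 h2
        rw [h1, h2]
      · rw [if_neg hex] at hT
        exact absurd hT (notMem_empty _)
  rw [hrepr]
  refine MeasurableSet.iUnion fun T => ?_
  split_ifs
  · exact hE T
  · exact MeasurableSet.empty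

/-- **The `n`-th partner of `i` is measurable on the good set.** [folklore] -/
theorem measurable_nthPartnerOf_restrict (Φ : HardSphereFlow (Torus.geometry d) ε N) (i : Fin N) (n : ℕ) :
    Measurable fun z : Φ.good => Φ.nthPartnerOf i n (z : Config N d (UnitAddTorus d)) :=
  (measurable_partner i).comp (measurable_flow_nthCollisionTimeOf_restrict Φ i n)

/-- **The record of the `n`-th collision of `i` is measurable on the good set.** [folklore] -/
theorem measurable_nthRecordOf_restrict (Φ : HardSphereFlow (Torus.geometry d) ε N) (i : Fin N) (n : ℕ) :
    Measurable fun z : Φ.good => Φ.nthRecordOf i n (z : Config N d (UnitAddTorus d)) := by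
  -- ofConfig is jointly measurable in (time, configuration), for each of the finitely many partners
  have hg : Measurable fun q : (ℝ × Config N d (UnitAddTorus d)) × Fin N =>
      HardSphereCollisionRecord.ofConfig (Torus.geometry d) ε q.1.2 q.1.1 i q.2 :=
    measurable_from_prod_countable_left fun j =>
      HardSphereCollisionRecord.measurable_ofConfig₂_torus ε i j
  have harg : Measurable fun z : Φ.good =>
      ((Φ.nthCollisionTimeOf i n (z : Config N d (UnitAddTorus d)),
        Φ.flow (Φ.nthCollisionTimeOf i n (z : Config N d (UnitAddTorus d))) (z : Config N d (UnitAddTorus d))),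
        Φ.nthPartnerOf i n (z : Config N d (UnitAddTorus d))) :=
    ((measurable_nthCollisionTimeOf_restrict Φ i n).prodMk (measurable_flow_nthCollisionTimeOf_restrict Φ i n)).prodMk
      (measurable_nthPartnerOf_restrict Φ i n)
  exact hg.comp harg

/-- **The kick event is measurable on the good set**: for measurable `B`, the crux's
`A = {z | (Φ.nthRecordOf i n z).outDir ∈ B}` satisfies `MeasurableSet (Φ.good ∩ A)`. [folklore] -/
theorem measurableSet_good_inter_outDir_nthRecordOf_mem : ∀ {d : Type*} [Fintype d] {N : ℕ} {ε : ℝ} (Φ : Literature.Analysis.FluidPDE.HardSphereFlow (Literature.Analysis.FluidPDE.Torus.geometry d) ε N) (i : Fin N) (n : ℕ) {B : Set (EuclideanSpace ℝ d)}, MeasurableSet B → MeasurableSet (Φ.good ∩ {z : Literature.Analysis.FluidPDE.Config N d (UnitAddTorus d) | (Φ.nthRecordOf i n z).outDir ∈ B}) := by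
  intro d _ N ε Φ i n B hB
  have hm : Measurable fun z : Φ.good =>
      (Φ.nthRecordOf i n (z : Config N d (UnitAddTorus d))).outDir :=
    HardSphereCollisionRecord.measurable_outDir.comp (measurable_nthRecordOf_restrict Φ i n)
  have hrepr : Φ.good ∩ {z : Config N d (UnitAddTorus d) | (Φ.nthRecordOf i n z).outDir ∈ B} =
      Subtype.val '' ((fun z : Φ.good => (Φ.nthRecordOf i n (z : Config N d (UnitAddTorus d))).outDir) ⁻¹' B) := by
    ext z
    simp only [mem_inter_iff, mem_setOf_eq, mem_image, mem_preimage, Subtype.exists, exists_and_right,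
      exists_eq_right]
    constructor
    · rintro ⟨hz, h⟩; exact ⟨hz, h⟩
    · rintro ⟨hz, h⟩; exact ⟨hz, h⟩
  rw [hrepr]
  exact Φ.measurableSet_good.subtype_image (hm hB)

end Summit.AtomisticToContinuum.HydrodynamicLimit.Theorems
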